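import Summits.ABC.IUTFork.Cor312RamifiedEPolydiscs
import HarnessLib

/-!
# [IUTchIII] Cor. 3.12 — the RAMIFIED SHEAR bed at GENERAL ramification index `e`, III: the EXACT hull of an (Ind1),(Ind2)-orbit

Record-only file (D-0012; MODEL DATA `indG`/`orbitUnion`/`hullIdx`, then proofs; no `Prop` fact, nothing asserted about print) of
the abc-iut cell, IUT REPAIR BRANCH (rung LADDER-ABC:A2.RP), seat abc-iut-rp-m1 (gen 4; class (ii) = Mochizuki's replies). TAKES NO
SIDE on [IUTchIII] Cor. 3.12. Sequel to `Cor312RamifiedEShells` (rank-`e` shells, Ism = `GL_e(ℤ_(p))` — the Dupuy–Hilado reading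
[cite: DupuyHilado2025, §4.9]; `actsIntegrally_of_mem_closure`; the reversal family) and `Cor312RamifiedEPolydiscs` (the polydiscs
`box k = {x | ∀ ε, x_ε = 0 ∨ e·v_p(x_ε) + wt ε ≥ k}` standing for `π^k·𝒪_L`, `wt ε ≤ wmax = (j+1)(e−1)`, the frame `rFrame`,
`μ(box k) = −(k/e)·log p`).
It generalises the seat's gen-3 `Cor312RamifiedPolydiscs` §3 (`e = 2`, hull `box (2⌈(k−j−1)/2⌉)`) — row RP-M47 of
HOME/plan/repair/CANDIDATES.tsv ([Rpt2018] (VUC3) p. 14 l. 11–32, (†ΘCR) p. 16 l. 58–66, (SSIdFs) p. 16 l. 68–70: «(Ind1), (Ind2)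
cannot be eliminated»).

**THE EXACT ORBIT HULL** (`hull_orbitUnion`): for every `k` and label `j` (`e ≥ 1`),
`hull(⋃_{Φ ∈ ⟨Ind1∪Ind2⟩} Φ(box k)) = box (e·hullIdx e k wmax)`, `hullIdx e k W = ⌈(k − W)/e⌉` (`hullIdx_bounds`:
`k − W ≤ e·hullIdx ≤ k − W + e − 1`) — UPPER BOUND because every `Φ` preserves the log-shell lattice `𝕀` and
`box k ⊆ p^a·𝕀 ⊆ box (e·a)`, LOWER BOUND because the reversal family carries `p^a·e_{π^{e−1}…π^{e−1}} ∈ box k` to `p^a·e_{1…1}`.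
So un-rigidifying Ism to `GL_e(ℤ_(p))` INFLATES the hull of a Θ-box by `k − e·hullIdx ∈ [j(e−1), (j+1)(e−1)]` `π`-steps
(`orbit_gain_bounds`), i.e. by between `j·(e−1)/e·log p` and `(j+1)·(e−1)/e·log p` — the size of the LOG-DIFFERENT of the tensor
packet (`(e−1)/e·log p` per tame factor), independent of `k`; at `e = 1` nothing (`orbit_gain_unramified`). Sequel
`Cor312RamifiedESetting`: the setting RAM_e(p, m). Interface-level toy over `toyIndex`; not a model of initial Θ-data; no judgement
on print. [claim: Mochizuki2012, status: disputed]
-/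

noncomputable section

namespace Summit.ABC.IUTFork.Cor312Vol.RamifiedEWitness

open Set Thm311 Cor312 Cor312.Checks Cor312.IdentifiedNonVacuity NaiveWitness Literature.IUT.LogThetaLattice
open RamifiedWitness (PLe IsPInt ple_zero isPInt_one fib eq_fib ple_ppow_iff)

variable (p e : ℕ)

/-! ## 1. The orbit union and the hull index -/

/-- The subgroup generated by (Ind1), (Ind2) of the ramified shells of index `e` (`Setting.indGroup` of any situation on these
shells). [folklore] -/
abbrev indG : Subgroup (ramShellsE p e).PacketAut :=
  Subgroup.closure ((ramShellsE p e).Ind1Family ∪ (ramShellsE p e).Ind2Family)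

/-- The UNION OF THE ORBIT of `box k` under `⟨(Ind1) ∪ (Ind2)⟩` (the shape of c312-7's `⋃₀ possibleImages`). [folklore] -/
def orbitUnion (j : toyIndex.Label) (vQ : toyIndex.VQ) (k : ℤ) : Set ((ramShellsE p e).Packet j vQ) :=
  ⋃₀ {U | ∃ Φ ∈ indG p e, U = Φ j vQ '' box p e j vQ k}

/-- **The hull index** `hullIdx e k W := ⌈(k − W)/e⌉` (as `(k − W + e − 1)/e`, floor division): the exponent `a` of the smallest
`p^a·𝕀` containing `box k` when `W` is the maximal weight. [folklore] -/
def hullIdx (k W : ℤ) : ℤ := (k - W + e - 1) / e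

variable {p e}

/-- **`k − W ≤ e·hullIdx e k W ≤ k − W + (e − 1)`** for `e ≥ 1`. [folklore] -/
theorem hullIdx_bounds (he : 1 ≤ e) (k W : ℤ) :
    k - W ≤ (e : ℤ) * hullIdx e k W ∧ (e : ℤ) * hullIdx e k W ≤ k - W + ((e : ℤ) - 1) := by
  unfold hullIdx
  have he' : 0 < (e : ℤ) := by exact_mod_cast he
  have h1 := Int.mul_ediv_add_emod (k - W + e - 1) e
  have h2 := Int.emod_nonneg (k - W + e - 1) he'.ne'
  have h3 := Int.emod_lt_of_pos (k - W + e - 1) he'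
  constructor <;> omega

/-- The hull index is CHARACTERISED by its two bounds: any `a` with `k − W ≤ e·a ≤ k − W + (e−1)` equals `hullIdx e k W`. [folklore] -/
theorem hullIdx_unique (he : 1 ≤ e) {k W a : ℤ} (h1 : k - W ≤ (e : ℤ) * a) (h2 : (e : ℤ) * a ≤ k - W + ((e : ℤ) - 1)) :
    a = hullIdx e k W := by
  have hb := hullIdx_bounds he k W
  have he' : (0 : ℤ) ≤ e := by positivity
  have h3 : (e : ℤ) * a < (e : ℤ) * (hullIdx e k W + 1) := by rw [mul_add, mul_one]; omega
  have h4 : (e : ℤ) * hullIdx e k W < (e : ℤ) * (a + 1) := by rw [mul_add, mul_one]; omega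
  have h5 := Int.lt_of_mul_lt_mul_left h3 he'
  have h6 := Int.lt_of_mul_lt_mul_left h4 he'
  omega

/-- **`hullIdx 1 k W = k − W`** (the unramified index `e = 1`: no rounding). [folklore] -/
theorem hullIdx_one (k W : ℤ) : hullIdx 1 k W = k - W := by
  unfold hullIdx; simp

section WithPrime

variable [hp : Fact p.Prime]

/-- A vector of `box k` becomes INTEGRAL after division by `p^a` whenever `e·a ≤ k − wmax + (e − 1)` (every nonzero coordinate has
`e·v_p ≥ k − wt ≥ k − wmax > e·(a − 1)`). [folklore] -/
theorem integral_ppow_smul_of_mem_box {j : toyIndex.Label} {vQ : toyIndex.VQ} {k a : ℤ} {x : (ramShellsE p e).Packet j vQ}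
    (hx : x ∈ box p e j vQ k) (ha : (e : ℤ) * a ≤ k - wmax e j + ((e : ℤ) - 1)) :
    Integral p e j vQ ((p : ℚ) ^ (-a) • x) := fun ε => by
  show PLe p 0 _
  rw [coord_smul]
  rcases eq_or_ne (coord p e j vQ x ε) 0 with h0 | h0
  · rw [h0, mul_zero]; exact ple_zero 0
  rcases hx ε with h | h
  · exact absurd h h0
  have hw := wt_le (e := e) ε
  have he' : (0 : ℤ) ≤ e := by positivity
  have h1 : (e : ℤ) * a < (e : ℤ) * (padicValRat p (coord p e j vQ x ε) + 1) := by rw [mul_add, mul_one]; omega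
  have h2 := Int.lt_of_mul_lt_mul_left h1 he'
  refine Or.inr ?_
  rw [padicValRat.mul (ppow_ne_zero p (-a)) h0, padicValRat_ppow]
  omega

/-- An integral vector scaled by `p^a` lies in `box (e·a)`. [folklore] -/
theorem ppow_smul_mem_box_of_integral {j : toyIndex.Label} {vQ : toyIndex.VQ} {y : (ramShellsE p e).Packet j vQ}
    (hy : Integral p e j vQ y) (a : ℤ) : (p : ℚ) ^ a • y ∈ box p e j vQ (e * a) := by
  rw [ppow_smul_mem_box_iff, sub_self]
  intro ε
  rcases eq_or_ne (coord p e j vQ y ε) 0 with h0 | h0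
  · exact Or.inl h0
  rcases hy ε with h | h
  · exact absurd h h0
  have he' : (0 : ℤ) ≤ e := by positivity
  exact Or.inr (by nlinarith [Int.mul_le_mul_of_nonneg_left h he'])

/-- **UPPER BOUND: every element of `⟨(Ind1) ∪ (Ind2)⟩` maps `box k` into `box (e·a)` whenever `e·a ≤ k − wmax + (e − 1)`** — because
it preserves the log-shell lattice `𝕀` (`actsIntegrally_of_mem_closure`) and `box k ⊆ p^a·𝕀 ⊆ box (e·a)`. [folklore] -/
theorem image_box_subset_box {Φ : (ramShellsE p e).PacketAut} (hΦ : Φ ∈ indG p e) (j : toyIndex.Label) (vQ : toyIndex.VQ)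
    {k a : ℤ} (ha : (e : ℤ) * a ≤ k - wmax e j + ((e : ℤ) - 1)) : Φ j vQ '' box p e j vQ k ⊆ box p e j vQ (e * a) := by
  rintro _ ⟨x, hx, rfl⟩
  have hp0 : (p : ℚ) ≠ 0 := Nat.cast_ne_zero.mpr hp.out.ne_zero
  have h : Φ j vQ x = (p : ℚ) ^ a • Φ j vQ ((p : ℚ) ^ (-a) • x) := by
    rw [map_smul, smul_smul, ← zpow_add₀ hp0, add_neg_cancel, zpow_zero, one_smul]
  rw [h]
  exact ppow_smul_mem_box_of_integral ((actsIntegrally_of_mem_closure hΦ).fwd j vQ _ (integral_ppow_smul_of_mem_box hx ha)) a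

/-- The orbit union lies in `box (e·hullIdx e k wmax)` (`e ≥ 1`). [folklore] -/
theorem orbitUnion_subset (he : 1 ≤ e) (j : toyIndex.Label) (vQ : toyIndex.VQ) (k : ℤ) :
    orbitUnion p e j vQ k ⊆ box p e j vQ (e * hullIdx e k (wmax e j)) := by
  rintro x ⟨U, ⟨Φ, hΦ, rfl⟩, hx⟩
  exact image_box_subset_box hΦ j vQ (hullIdx_bounds he k (wmax e j)).2 hx

/-- **LOWER BOUND (the mover): the reversal family carries `p^a·e_{π^{e−1}…π^{e−1}} ∈ box k` (`a = hullIdx e k wmax`) to `p^a·e_{1…1}`,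
a point of the orbit union lying in NO box smaller than `box (e·a)`.** [folklore] -/
theorem revPoint_mem_orbitUnion [NeZero e] (j : toyIndex.Label) (vQ : toyIndex.VQ) (k : ℤ) :
    (p : ℚ) ^ (hullIdx e k (wmax e j)) • tb p e j vQ (zeros e j) ∈ orbitUnion p e j vQ k := by
  refine ⟨revFam p e j vQ '' box p e j vQ k, ⟨revFam p e, revFam_mem_closure p e, rfl⟩,
    (p : ℚ) ^ (hullIdx e k (wmax e j)) • tb p e j vQ (tops e j), ?_, ?_⟩
  · rw [ppow_smul_tb_mem_box_iff, wt_tops]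
    have h := (hullIdx_bounds (NeZero.one_le (n := e)) k (wmax e j)).1
    omega
  · rw [map_smul, revFam_tb, rev_tops]

/-- The orbit union is NOT contained in `box (e·hullIdx e k wmax + 1)` (`e ≥ 1`). [folklore] -/
theorem not_orbitUnion_subset_succ [NeZero e] (j : toyIndex.Label) (vQ : toyIndex.VQ) (k : ℤ) :
    ¬ orbitUnion p e j vQ k ⊆ box p e j vQ (e * hullIdx e k (wmax e j) + 1) := fun h => by
  have h1 := h (revPoint_mem_orbitUnion j vQ k)
  rw [ppow_smul_tb_mem_box_iff, wt_zeros] at h1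
  push_cast at h1
  omega

/-- **THE EXACT HULL OF THE ORBIT: `hull(⋃_{Φ ∈ ⟨Ind1∪Ind2⟩} Φ(box k)) = box (e·⌈(k − (j+1)(e−1))/e⌉)`** on the packet at label `j`
(`e ≥ 1`). Un-rigidifying Ism to the full lattice-automorphism group inflates the hull of `box k` by `k − e·hullIdx ∈ [j(e−1), (j+1)(e−1)]`
`π`-steps `(1/e)·log p` (`orbit_gain_bounds`). [claim: Mochizuki2012, status: disputed] -/
theorem hull_orbitUnion [NeZero e] (j : toyIndex.Label) (vQ : toyIndex.VQ) (k : ℤ) :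
    (rFrame p e j vQ).hull (orbitUnion p e j vQ k) = box p e j vQ (e * hullIdx e k (wmax e j)) :=
  hull_eq_box (orbitUnion_subset (NeZero.one_le (n := e)) j vQ k) (not_orbitUnion_subset_succ j vQ k)

/-- The orbit union is bounded and admits its hull (c312-7's `HullDefined`; `e ≥ 1`). [folklore] -/
theorem orbitUnion_bounded_hasHull [NeZero e] (j : toyIndex.Label) (vQ : toyIndex.VQ) (k : ℤ) :
    (rFrame p e j vQ).IsBounded (orbitUnion p e j vQ k) ∧ (rFrame p e j vQ).HasHull (orbitUnion p e j vQ k) :=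
  ⟨⟨_, orbitUnion_subset (NeZero.one_le (n := e)) j vQ k⟩, _, revPoint_mem_orbitUnion j vQ k, ppow_smul_tb_ne_zero j vQ _ _⟩

omit hp in
/-- **The gain in `π`-steps**: `(j+1)(e−1) − (e−1) ≤ k − e·hullIdx ≤ (j+1)(e−1)` — between `j` and `j+1` log-differents `(e−1)/e·log p`,
for EVERY `k`: (Ind1),(Ind2) are never eliminable from the hull on these packets once `e ≥ 2`, `j ≥ 1`. [folklore] -/
theorem orbit_gain_bounds (he : 1 ≤ e) (j : toyIndex.Label) (k : ℤ) :
    wmax e j - ((e : ℤ) - 1) ≤ k - e * hullIdx e k (wmax e j) ∧ k - e * hullIdx e k (wmax e j) ≤ wmax e j := by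
  have hb := hullIdx_bounds he k (wmax e j)
  constructor <;> omega

omit hp in
/-- **Unramified index `e = 1`: no gain at all** (`hull = box k`; `GL_1(ℤ_(p)) = ℤ_(p)^×` consists of isometries). [folklore] -/
theorem orbit_gain_unramified (j : toyIndex.Label) (k : ℤ) : ((1 : ℕ) : ℤ) * hullIdx 1 k (wmax 1 j) = k := by
  rw [hullIdx_one]
  unfold wmax
  push_cast
  ring

/-- **Volume form**: `μ(hull of the orbit of box k) = μ(box k) + ((k − e·hullIdx)/e)·log p ≥ μ(box k) + (j(e−1)/e)·log p`. [folklore] -/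
theorem rVol_hull_orbitUnion [NeZero e] (j : toyIndex.Label) (vQ : toyIndex.VQ) (k : ℤ) :
    rVol p e j vQ ((rFrame p e j vQ).hull (orbitUnion p e j vQ k)) =
      rVol p e j vQ (box p e j vQ k) + (((k - e * hullIdx e k (wmax e j) : ℤ) : ℝ) / e) * Real.log p := by
  rw [hull_orbitUnion, rVol_box, rVol_box]
  have he : (e : ℝ) ≠ 0 := Nat.cast_ne_zero.mpr (NeZero.ne e)
  push_cast
  field_simp
  ring

end WithPrime

end Summit.ABC.IUTFork.Cor312Vol.RamifiedEWitness

end
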